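import Mathlib
import Literature.NumberTheory.LFunctions.MultiplicativeAutomatic

/-!
# Base-`q` additive digital functions mod 2 are `q`-automatic (kernel formulation)

A function `c : ℕ → 𝔽₂` is `q`-ADDITIVE (in the strong, digital sense) if
`c (q^i n + r) = c n + c r` whenever `i ≥ 1` and `r < q^i`: the low `i` base-`q` digits of
`q^i n + r` are those of `r`, the remaining ones those of `n`. Examples (`q = 2^b`): aligned
block-diagonal phases `Σ_j B(d_j(N))` over the base-`q` digits `d_j`, e.g. the inner-product bent
function `x₀x₁ + x₂x₃ + ⋯` of the binary digits (`q = 4`). For every `Φ : 𝔽₂ → ℂ` the sequence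
`N ↦ Φ (c N)` is `q`-automatic in the tree's kernel sense
(`Literature.NumberTheory.LFunctions.IsAutomaticSeq q`, finite `q`-kernel): every kernel element
`n ↦ Φ (c (q^i n + r))` equals `n ↦ Φ (c n + c r)`, so the kernel lies in the finite family
`{n ↦ Φ (c n + s) : s ∈ 𝔽₂}`.
Helper for line Sketch of crux stmt-QuantumAdvantage-1392 (automatic digital phases are
orthogonal to the Liouville function modulo Müllner 2017).
-/

set_option linter.dupNamespace false -- D-0017: single-problem summit ⇒ QuantumAdvantage.QuantumAdvantage by design
set_option autoImplicit false

namespace Summit.QuantumAdvantage.QuantumAdvantage.Theorems.MobiusLadder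

/-- **`q`-additive digital functions mod 2 are `q`-automatic.** If `c : ℕ → 𝔽₂` satisfies
`c (q^i n + r) = c n + c r` for all `i ≥ 1`, `r < q^i`, then for every `Φ : 𝔽₂ → ℂ` the sequence
`N ↦ Φ (c N)` has finite `q`-kernel: each kernel element `n ↦ Φ (c (q^i n + r))` is
`n ↦ Φ (c n + c r)`, a member of the finite family `{n ↦ Φ (c n + s) : s ∈ 𝔽₂}`.
(The hypothesis `2 ≤ q` is not used.) [folklore] -/
theorem isAutomaticSeq_of_baseAdditive :
    ∀ q : ℕ, 2 ≤ q → ∀ c : ℕ → ZMod 2, (∀ i n r : ℕ, 1 ≤ i → r < q ^ i → c (q ^ i * n + r) = c n + c r) → ∀ Φ : ZMod 2 → ℂ, Literature.NumberTheory.LFunctions.IsAutomaticSeq q (fun N => Φ (c N)) := by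
  intro q _ c hadd Φ
  refine (Set.finite_range (fun s : ZMod 2 => fun n : ℕ => Φ (c n + s))).subset ?_
  rintro g ⟨i, hi, r, hr, rfl⟩
  exact ⟨c r, funext fun n => (congrArg Φ (hadd i n r hi hr)).symm⟩

end Summit.QuantumAdvantage.QuantumAdvantage.Theorems.MobiusLadder
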